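import Mathlib

/-!
# Stub `stub_rhWalkup` of `SnSubsetDichotomy.ThresholdSubsetTriples`, line `SketchIdeator6`

Line `SketchIdeator6` is the genus / Riemann–Hurwitz certificate.

Registered stub `stub_rhWalkup` of the lead skeleton (crux `stmt-MatrixMultiplication-10882`).
The Walkup (point-deletion) step of the Riemann–Hurwitz / Euler inequality for permutation pairs,
from the two transposition lemmas (cycle split/merge under a transposition, orbit merge under an
adjoined transposition), which enter as hypotheses.
-/

namespace Summit.MatrixMultiplication.MatrixMultiplication.Theorems.ThresholdSubsetTriples

open Equiv MulAction Subgroup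

/-! ### Embedding `Perm β ↪ Perm (Option β)` along `optionCongr`: orbit counts grow by one -/

section Embed

variable {β : Type} [Fintype β]

/-- Transporting a permutation group `G` of `β` to `Option β` along `optionCongr` adds exactly one
orbit, the fixed point `none`. -/
theorem walkup_card_quot_map (G : Subgroup (Perm β)) (f : Perm β →* Perm (Option β))
    (hf : ∀ e, f e = Equiv.optionCongr e) :
    Nat.card (orbitRel.Quotient (G.map f) (Option β)) = Nat.card (orbitRel.Quotient G β) + 1 := by
  classical
  set q : Option β → Option (orbitRel.Quotient G β) := Option.map (Quotient.mk _)
  have hq : Function.Surjective q := by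
    rintro (_ | x)
    · exact ⟨none, rfl⟩
    · obtain ⟨b, rfl⟩ := Quotient.mk_surjective x
      exact ⟨some b, rfl⟩
  have hmem : ∀ x y : Option β, x ∈ orbit (G.map f) y ↔ ∃ g ∈ G, Option.map g y = x := by
    intro x y
    constructor
    · rintro ⟨⟨k, hk⟩, rfl⟩
      obtain ⟨g, hg, rfl⟩ := Subgroup.mem_map.1 hk
      exact ⟨g, hg, by simp [Subgroup.mk_smul, hf]⟩
    · rintro ⟨g, hg, rfl⟩
      exact mem_orbit_iff.2
        ⟨⟨f g, Subgroup.mem_map_of_mem f hg⟩, by simp [Subgroup.mk_smul, hf]⟩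
  have heq : ∀ a b : β,
      (Quotient.mk (orbitRel G β) a = Quotient.mk _ b) ↔ ∃ g ∈ G, g b = a := by
    intro a b
    rw [Quotient.eq]
    change a ∈ orbit G b ↔ _
    rw [mem_orbit_iff]
    constructor
    · rintro ⟨⟨g, hg⟩, h⟩
      exact ⟨g, hg, h⟩
    · rintro ⟨g, hg, h⟩
      exact ⟨⟨g, hg⟩, h⟩
  have key : ∀ x y : Option β, orbitRel (G.map f) (Option β) x y ↔ Setoid.ker q x y := by
    intro x y
    rw [orbitRel_apply, Setoid.ker_def, hmem]
    rcases x with _ | a <;> rcases y with _ | b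
    · exact ⟨fun _ => rfl, fun _ => ⟨1, one_mem _, rfl⟩⟩
    · simp [q]
    · simp [q]
    · simp [q, heq]
  have e1 :
      Nat.card (orbitRel.Quotient (G.map f) (Option β)) = Nat.card (Quotient (Setoid.ker q)) :=
    Nat.card_congr (Quotient.congrRight key)
  rw [e1, Nat.card_congr (Setoid.quotientKerEquivOfSurjective q hq), Finite.card_option]

/-- The three instances of `walkup_card_quot_map` used in the Walkup step, phrased via
`map_equiv_removeNone : (removeNone σ).optionCongr = swap none (σ none) * σ`. -/
theorem walkup_embed [DecidableEq β] (σ τ : Perm (Option β)) :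
    Nat.card (orbitRel.Quotient (zpowers (swap none (σ none) * σ)) (Option β)) =
        Nat.card (orbitRel.Quotient (zpowers (Equiv.removeNone σ)) β) + 1 ∧
      Nat.card (orbitRel.Quotient (zpowers (swap none (σ none) * σ * (swap none (τ none) * τ)))
          (Option β)) =
        Nat.card (orbitRel.Quotient (zpowers (Equiv.removeNone σ * Equiv.removeNone τ)) β) +
          1 ∧
      Nat.card (orbitRel.Quotient (closure ({swap none (σ none) * σ, swap none (τ none) * τ} :
          Set (Perm (Option β)))) (Option β)) =
        Nat.card (orbitRel.Quotient (closure ({Equiv.removeNone σ, Equiv.removeNone τ} :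
          Set (Perm β))) β) + 1 := by
  obtain ⟨f, hf⟩ : ∃ f : Perm β →* Perm (Option β), ∀ e, f e = Equiv.optionCongr e :=
    ⟨MonoidHom.mk' (fun e : Perm β => (Equiv.optionCongr e : Perm (Option β)))
      (fun a b => by ext x : 1; simp), fun _ => rfl⟩
  have h1 : ∀ π : Perm (Option β), swap none (π none) * π = f (Equiv.removeNone π) :=
    fun π => by rw [hf, map_equiv_removeNone]
  refine ⟨?_, ?_, ?_⟩
  · rw [h1, ← MonoidHom.map_zpowers]
    exact walkup_card_quot_map _ f hf
  · rw [h1, h1, ← map_mul, ← MonoidHom.map_zpowers]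
    exact walkup_card_quot_map _ f hf
  · rw [h1, h1,
      show ({f (Equiv.removeNone σ), f (Equiv.removeNone τ)} : Set (Perm (Option β))) =
        f '' {Equiv.removeNone σ, Equiv.removeNone τ} from (Set.image_pair _ _ _).symm,
      ← MonoidHom.map_closure]
    exact walkup_card_quot_map _ f hf

end Embed

/-! ### The Walkup step inside `Perm Ω` with a distinguished point `z` -/

section Core

variable {Ω : Type}

/-- An element `π ∈ G` with `π x = y` witnesses `y ∈ orbit G x`. -/
theorem walkup_mem_orbit {G : Subgroup (Perm Ω)} {π : Perm Ω} (hπ : π ∈ G) {x y : Ω}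
    (h : π x = y) : y ∈ orbit G x :=
  mem_orbit_iff.2 ⟨⟨π, hπ⟩, h⟩

/-- A group of permutations fixing `z` cannot move a point `x ≠ z` to `z`. -/
theorem walkup_not_mem_orbit (G : Subgroup (Perm Ω)) {z x : Ω} (hG : ∀ g ∈ G, g z = z)
    (hx : x ≠ z) : z ∉ orbit G x := by
  intro h
  obtain ⟨⟨g, hg⟩, h⟩ := mem_orbit_iff.1 h
  have h' : g x = z := h
  apply hx
  calc x = g⁻¹ (g x) := by simp
    _ = g⁻¹ z := by rw [h']
    _ = z := hG _ (inv_mem hg)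

/-- One inclusion of `walkup_sup_eq`. -/
theorem walkup_sup_le (σ τ s₁ s₂ : Perm Ω) :
    closure ({s₁ * σ, s₂ * τ} : Set (Perm Ω)) ⊔ zpowers s₁ ⊔ zpowers s₂ ≤
      closure ({σ, τ} : Set (Perm Ω)) ⊔ zpowers s₁ ⊔ zpowers s₂ := by
  refine sup_le (sup_le ((closure_le _).2 ?_) (le_sup_right.trans le_sup_left)) le_sup_right
  rintro g (rfl | rfl)
  · exact mul_mem (mem_sup_left (mem_sup_right (mem_zpowers _)))
      (mem_sup_left (mem_sup_left (subset_closure (by simp))))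
  · exact mul_mem (mem_sup_right (mem_zpowers _))
      (mem_sup_left (mem_sup_left (subset_closure (by simp))))

variable [DecidableEq Ω]

/-- The Walkup-transformed generators `swap z (σ z) * σ`, `swap z (τ z) * τ` both fix `z`, hence
so does the group they generate. -/
theorem walkup_closure_fix (σ τ : Perm Ω) (z u v : Ω) (hu : σ z = u) (hv : τ z = v) :
    ∀ g ∈ closure ({swap z u * σ, swap z v * τ} : Set (Perm Ω)), g z = z := by
  intro g hg
  have hle :
      closure ({swap z u * σ, swap z v * τ} : Set (Perm Ω)) ≤ stabilizer (Perm Ω) z := by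
    rw [closure_le]
    rintro g (rfl | rfl) <;> simp [mem_stabilizer_iff, Perm.mul_apply, hu, hv]
  simpa [mem_stabilizer_iff] using hle hg

/-- Adjoining the two transpositions, the original pair `{σ, τ}` and the Walkup pair generate the
same group. -/
theorem walkup_sup_eq (σ τ : Perm Ω) (a b c d : Ω) :
    closure ({swap a b * σ, swap c d * τ} : Set (Perm Ω)) ⊔ zpowers (swap a b) ⊔
        zpowers (swap c d) =
      closure ({σ, τ} : Set (Perm Ω)) ⊔ zpowers (swap a b) ⊔ zpowers (swap c d) :=
  le_antisymm (walkup_sup_le _ _ _ _)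
    (by simpa using walkup_sup_le (swap a b * σ) (swap c d * τ) (swap a b) (swap c d))

/-- **Walkup step in `Perm Ω`.** With `u = σ z`, `v = τ z`, the transformed pair
`σ̃ = swap z u * σ`, `τ̃ = swap z v * τ` (both fixing `z`) satisfies
`cyc σ + cyc τ + cyc (σ τ) + 2·orb ⟨σ̃, τ̃⟩ ≤ cyc σ̃ + cyc τ̃ + cyc (σ̃ τ̃) + 2·orb ⟨σ, τ⟩`,
where `cyc π` counts the orbits of `zpowers π` and `orb` those of the subgroup. -/
theorem walkup_core
    (hsplit : ∀ (π : Perm Ω) (a b : Ω), a ≠ b → π.SameCycle a b →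
      (∀ x, π.SameCycle a x ↔
          (swap a b * π).SameCycle a x ∨ (swap a b * π).SameCycle b x) ∧
        Nat.card (orbitRel.Quotient (zpowers (swap a b * π)) Ω) =
          Nat.card (orbitRel.Quotient (zpowers π) Ω) + 1)
    (hmerge : ∀ (π : Perm Ω) (a b : Ω), a ≠ b → ¬ π.SameCycle a b →
      (swap a b * π).SameCycle a b ∧
        Nat.card (orbitRel.Quotient (zpowers (swap a b * π)) Ω) + 1 =
          Nat.card (orbitRel.Quotient (zpowers π) Ω))
    (hsame : ∀ (H : Subgroup (Perm Ω)) (a b : Ω), a ∈ orbit H b →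
      Nat.card (orbitRel.Quotient (H ⊔ zpowers (swap a b) : Subgroup (Perm Ω)) Ω) =
        Nat.card (orbitRel.Quotient H Ω))
    (hdiff : ∀ (H : Subgroup (Perm Ω)) (a b : Ω), a ∉ orbit H b →
      Nat.card (orbitRel.Quotient (H ⊔ zpowers (swap a b) : Subgroup (Perm Ω)) Ω) + 1 =
        Nat.card (orbitRel.Quotient H Ω))
    (σ τ : Perm Ω) (z u v : Ω) (hu : σ z = u) (hv : τ z = v)
    (H Ht : Subgroup (Perm Ω)) (hH : H = closure ({σ, τ} : Set (Perm Ω)))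
    (hHt : Ht = closure ({swap z u * σ, swap z v * τ} : Set (Perm Ω))) :
    Nat.card (orbitRel.Quotient (zpowers σ) Ω) + Nat.card (orbitRel.Quotient (zpowers τ) Ω) +
          Nat.card (orbitRel.Quotient (zpowers (σ * τ)) Ω) +
        2 * Nat.card (orbitRel.Quotient Ht Ω) ≤
      Nat.card (orbitRel.Quotient (zpowers (swap z u * σ)) Ω) +
            Nat.card (orbitRel.Quotient (zpowers (swap z v * τ)) Ω) +
          Nat.card (orbitRel.Quotient (zpowers (swap z u * σ * (swap z v * τ))) Ω) +
        2 * Nat.card (orbitRel.Quotient H Ω) := by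
  -- splitting off a fixed point: `cyc (swap z (π z) * π) = cyc π + 1` when `π z ≠ z`
  have cswap : ∀ (π : Perm Ω) (z : Ω), π z ≠ z →
      Nat.card (orbitRel.Quotient (zpowers (swap z (π z) * π)) Ω) =
        Nat.card (orbitRel.Quotient (zpowers π) Ω) + 1 :=
    fun π z h => (hsplit π z (π z) h.symm ⟨1, by simp⟩).2
  have hσH : σ ∈ H := hH ▸ subset_closure (by simp)
  have hτH : τ ∈ H := hH ▸ subset_closure (by simp)
  have hσt : swap z u * σ ∈ Ht := hHt ▸ subset_closure (by simp)
  have hτt : swap z v * τ ∈ Ht := hHt ▸ subset_closure (by simp)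
  have o1 := hsame H z u (walkup_mem_orbit (inv_mem hσH) (by simp [← hu]))
  have o2 := hsame (H ⊔ zpowers (swap z u)) z v
    (walkup_mem_orbit (mem_sup_left (inv_mem hτH)) (by simp [← hv]))
  have hK : Ht ⊔ zpowers (swap z u) ⊔ zpowers (swap z v) =
      H ⊔ zpowers (swap z u) ⊔ zpowers (swap z v) := by
    rw [hH, hHt]; exact walkup_sup_eq σ τ z u z v
  have hfix : ∀ g ∈ Ht, g z = z := hHt ▸ walkup_closure_fix σ τ z u v hu hv
  have hw : (σ * τ) z = σ v := by rw [Perm.mul_apply, hv]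
  rcases eq_or_ne u z with hσ | hσ <;> rcases eq_or_ne v z with hτ | hτ
  · -- Case A: `σ z = z`, `τ z = z`; everything is unchanged.
    subst hσ hτ
    simp only [swap_self, ← Perm.one_def, one_mul] at hHt
    rw [swap_self, ← Perm.one_def, one_mul, one_mul, hHt, ← hH]
  · -- Case B: `σ z = z`, `τ z ≠ z`.
    subst hσ
    have e1 : swap u u = 1 := swap_self u
    have c2 : Nat.card (orbitRel.Quotient (zpowers (swap u v * τ)) Ω) =
        Nat.card (orbitRel.Quotient (zpowers τ) Ω) + 1 := hv ▸ cswap τ u (hv ▸ hτ)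
    have hw' : σ v ≠ u := fun h => hτ (σ.injective (h.trans hu.symm))
    have c3 : Nat.card (orbitRel.Quotient (zpowers (σ * (swap u v * τ))) Ω) =
        Nat.card (orbitRel.Quotient (zpowers (σ * τ)) Ω) + 1 := by
      rw [← mul_assoc, mul_swap_eq_swap_mul, hu, mul_assoc, ← hw]
      exact cswap (σ * τ) u (by rwa [hw])
    have o3 := hdiff Ht u v (walkup_not_mem_orbit _ hfix hτ)
    rw [e1, zpowers_one_eq_bot, sup_bot_eq, sup_bot_eq] at hK
    rw [hK, hsame _ u v (walkup_mem_orbit (inv_mem hτH) (by simp [← hv]))] at o3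
    rw [e1, one_mul]
    omega
  · -- Case C: `σ z ≠ z`, `τ z = z`.
    subst hτ
    have e2 : swap v v = 1 := swap_self v
    have c1 : Nat.card (orbitRel.Quotient (zpowers (swap v u * σ)) Ω) =
        Nat.card (orbitRel.Quotient (zpowers σ) Ω) + 1 := hu ▸ cswap σ v (hu ▸ hσ)
    have c3 : Nat.card (orbitRel.Quotient (zpowers (swap v u * σ * τ)) Ω) =
        Nat.card (orbitRel.Quotient (zpowers (σ * τ)) Ω) + 1 := by
      rw [mul_assoc, ← hu, ← hw]
      exact cswap (σ * τ) v (by rwa [hw, hu])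
    have o3 := hdiff Ht v u (walkup_not_mem_orbit _ hfix hσ)
    rw [e2, zpowers_one_eq_bot, sup_bot_eq, sup_bot_eq] at hK
    rw [hK, o1] at o3
    rw [e2, one_mul]
    omega
  · -- Cases D/E: `σ z ≠ z`, `τ z ≠ z`.
    have c1 : Nat.card (orbitRel.Quotient (zpowers (swap z u * σ)) Ω) =
        Nat.card (orbitRel.Quotient (zpowers σ) Ω) + 1 := hu ▸ cswap σ z (hu ▸ hσ)
    have c2 : Nat.card (orbitRel.Quotient (zpowers (swap z v * τ)) Ω) =
        Nat.card (orbitRel.Quotient (zpowers τ) Ω) + 1 := hv ▸ cswap τ z (hv ▸ hτ)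
    have o3 := hdiff Ht z u (walkup_not_mem_orbit _ hfix hσ)
    have o4 : Nat.card (orbitRel.Quotient
        (Ht ⊔ zpowers (swap z u) ⊔ zpowers (swap z v) : Subgroup (Perm Ω)) Ω) =
          Nat.card (orbitRel.Quotient H Ω) := by
      rw [hK, o2, o1]
    -- the product of the transformed pair
    have hprod :
        swap z u * σ * (swap z v * τ) = swap z (swap z u (σ v)) * (swap z u * (σ * τ)) := by
      conv_lhs => rw [← mul_assoc, mul_swap_eq_swap_mul, Perm.mul_apply, Perm.mul_apply, hu,
        swap_apply_right]
      simp only [mul_assoc]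
    rcases eq_or_ne (σ v) z with hwz | hwz
    · -- Case D: `σ τ` fixes `z`; the transformed product equals `σ τ`.
      rw [hwz, swap_apply_left, swap_mul_self_mul] at hprod
      have hσK : σ ∈ Ht ⊔ zpowers (swap z u) := by
        have := mul_mem (mem_sup_right (mem_zpowers (swap z u))) (mem_sup_left hσt :
          swap z u * σ ∈ Ht ⊔ zpowers (swap z u))
        rwa [swap_mul_self_mul] at this
      have o5 := hsame _ z v (walkup_mem_orbit hσK hwz)
      rw [hprod]
      omega
    · -- Case E: `z`, `u = σ z`, `w = σ v = (σ τ) z` are pairwise distinct.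
      have hwu : σ v ≠ u := fun h => hτ (σ.injective (h.trans hu.symm))
      rw [swap_apply_of_ne_of_ne hwz hwu] at hprod
      have hP : swap z (σ v) * (swap z u * (σ * τ)) ∈ Ht := hprod ▸ mul_mem hσt hτt
      have hYz : (swap z u * (σ * τ)) z = σ v := by
        rw [Perm.mul_apply, hw, swap_apply_of_ne_of_ne hwz hwu]
      have hsY := hsplit (swap z u * (σ * τ)) z (σ v) hwz.symm ⟨1, by rw [zpow_one, hYz]⟩
      rw [hprod, hsY.2]
      by_cases he : (σ * τ).SameCycle z u
      · -- ε = 1: two splits; the last transposition changes the orbit count by at most one.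
        have cY := (hsplit (σ * τ) z u hσ.symm he).2
        have o5 : Nat.card (orbitRel.Quotient (Ht ⊔ zpowers (swap z u) : Subgroup (Perm Ω)) Ω) ≤
            Nat.card (orbitRel.Quotient
              (Ht ⊔ zpowers (swap z u) ⊔ zpowers (swap z v) : Subgroup (Perm Ω)) Ω) + 1 := by
          by_cases hm : z ∈ orbit (Ht ⊔ zpowers (swap z u) : Subgroup (Perm Ω)) v
          · rw [hsame _ z v hm]; omega
          · rw [← hdiff _ z v hm]
        omega
      · -- ε = 0: a merge then a split, and `z ∈ orbit K₁ (τ z)` (δ = 0).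
        have hm := hmerge (σ * τ) z u hσ.symm he
        have hδ : z ∈ orbit (Ht ⊔ zpowers (swap z u) : Subgroup (Perm Ω)) v := by
          rcases (hsY.1 u).1 hm.1 with h1 | h2
          · refine absurd (h1.eq_of_left ?_).symm hσ
            change (swap z (σ v) * (swap z u * (σ * τ))) z = z
            rw [Perm.mul_apply, hYz, swap_apply_right]
          · obtain ⟨i, hi⟩ := h2
            refine walkup_mem_orbit (π := swap z u * (swap z (σ v) * (swap z u * (σ * τ))) ^ i *
              (swap z u * σ)) (mul_mem (mul_mem (mem_sup_right (mem_zpowers _))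
                (mem_sup_left (zpow_mem hP i))) (mem_sup_left hσt)) ?_
            simp only [Perm.mul_apply]
            rw [swap_apply_of_ne_of_ne hwz hwu, hi, swap_apply_right]
        have o5 := hsame _ z v hδ
        omega

end Core


/-- **Stub `stub_rhWalkup`.** Deleting `none` from `σ, τ : Perm (Option β)` by `Equiv.removeNone` does not increase the genus defect. [folklore; Walkup transform, Jacques 1968 / Gonthier] -/
theorem stub_rhWalkup : (∀ (α : Type) [Fintype α] [DecidableEq α] (σ : Equiv.Perm α) (a b : α), a ≠ b → (σ.SameCycle a b → ¬ (Equiv.swap a b * σ).SameCycle a b ∧ (∀ x y : α, ¬ σ.SameCycle a x → ((Equiv.swap a b * σ).SameCycle x y ↔ σ.SameCycle x y)) ∧ (∀ x : α, σ.SameCycle a x ↔ ((Equiv.swap a b * σ).SameCycle a x ∨ (Equiv.swap a b * σ).SameCycle b x)) ∧ Nat.card (MulAction.orbitRel.Quotient (Subgroup.zpowers (Equiv.swap a b * σ)) (α)) = Nat.card (MulAction.orbitRel.Quotient (Subgroup.zpowers σ) (α)) + 1) ∧ (¬ σ.SameCycle a b → (Equiv.swap a b * σ).SameCycle a b ∧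 (∀ x y : α, ¬ σ.SameCycle a x → ¬ σ.SameCycle b x → ((Equiv.swap a b * σ).SameCycle x y ↔ σ.SameCycle x y)) ∧ (∀ x : α, (Equiv.swap a b * σ).SameCycle a x ↔ (σ.SameCycle a x ∨ σ.SameCycle b x)) ∧ Nat.card (MulAction.orbitRel.Quotient (Subgroup.zpowers (Equiv.swap a b * σ)) (α)) + 1 = Nat.card (MulAction.orbitRel.Quotient (Subgroup.zpowers σ) (α)))) → (∀ (α : Type) [Fintype α] [DecidableEq α] (H : Subgroup (Equiv.Perm α)) (a b : α), (∀ x y : α, x ∈ MulAction.orbit (H ⊔ Subgroup.zpowers (Equiv.swap a b) : Subgroup (Equiv.Perm α)) y ↔ (x ∈ MulAction.orbit H y ∨ (x ∈ MulAction.orbit H a ∧ y ∈ MulAction.orbit H b) ∨ (x ∈ MulAction.orbit H b ∧ y ∈ MulAction.orbit H a))) ∧ (a ∈ MulAction.orbit H b → Nat.card (MulAction.orbitRel.Quotient ((H ⊔ Subgroup.zpowers (Equiv.swap a b) : Subgroup (Equiv.Perm α))) (α)) = Nat.card (MulAction.orbitRel.Quotient (H) (α))) ∧ (a ∉ MulAction.orbit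 H b → Nat.card (MulAction.orbitRel.Quotient ((H ⊔ Subgroup.zpowers (Equiv.swap a b) : Subgroup (Equiv.Perm α))) (α)) + 1 = Nat.card (MulAction.orbitRel.Quotient (H) (α)))) → ∀ (β : Type) [Fintype β] [DecidableEq β] (σ τ : Equiv.Perm (Option β)), Nat.card (MulAction.orbitRel.Quotient (Subgroup.zpowers σ) (Option β)) + Nat.card (MulAction.orbitRel.Quotient (Subgroup.zpowers τ) (Option β)) + Nat.card (MulAction.orbitRel.Quotient (Subgroup.zpowers (σ * τ)) (Option β)) + 2 * Nat.card (MulAction.orbitRel.Quotient (Subgroup.closure ({Equiv.removeNone σ, Equiv.removeNone τ} : Set (Equiv.Perm β))) (β)) ≤ Nat.card (MulAction.orbitRel.Quotient (Subgroup.zpowers (Equiv.removeNone σ)) (β)) + Nat.card (MulAction.orbitRel.Quotient (Subgroup.zpowers (Equiv.removeNone τ)) (β)) + Nat.card (MulAction.orbitRel.Quotient (Subgroup.zpowers (Equiv.removeNone σ * Equiv.removeNone τ)) (β)) + 1 + 2 * Nat.card (MulAction.orbitRel.Quotient (Subgroup.closure ({σ, τ} : Set (Equiv.Perm (Option β))))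 (Option β)) := by
  intro hSwap hOrb β _ _ σ τ
  obtain ⟨e1, e3, e4⟩ := walkup_embed σ τ
  obtain ⟨e2, -, -⟩ := walkup_embed τ σ
  have hS := hSwap (Option β)
  have hO := hOrb (Option β)
  have key := walkup_core (Ω := Option β)
    (fun π a b hab h => ⟨((hS π a b hab).1 h).2.2.1, ((hS π a b hab).1 h).2.2.2⟩)
    (fun π a b hab h => ⟨((hS π a b hab).2 h).1, ((hS π a b hab).2 h).2.2.2⟩)
    (fun G a b => (hO G a b).2.1) (fun G a b => (hO G a b).2.2) σ τ none (σ none) (τ none)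
    rfl rfl _ _ rfl rfl
  omega

end Summit.MatrixMultiplication.MatrixMultiplication.Theorems.ThresholdSubsetTriples
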